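import Summits.KontsevichZagierPeriods.Zeta5Search.LaiSweepShard

/-!
# `κ₃` sweep certificate — shard file 090 of 127 (shards 630–636 of 889)

HONEST FRAMING. Systematic search; no irrationality claim unless certified. This file only checks,
by `decide +kernel`, shards 630–636 of the order-cell sweep of the `κ₃` point `(74, 2180, 444; δ74)`
(engine `LaiSweepEngine`, soundness `LaiSweepJump/Free/Eval/Shard/Kappa3`; a shard is `⟨regime, n,
p, q, p', q', Lo, Up⟩`: `n` cells from `p/q` to `p'/q'` with integer rate sums in `[Lo, Up]`, `K =
128`, `D = 2^40`). It draws NO conclusion: only the capstone `LaiKappa3SweepCert`, which needs all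
127 shard files, does. Kernel cost of this file ≈ 560 cells × 0.3 s.
-/

namespace Summit.KontsevichZagierPeriods.Zeta5Search.Sweep

set_option maxHeartbeats 100000000 in
/-- Shard 630: 80 cells of regime B from `114/169` to `123/182`.
[cite: Lai2024BallRivoal, §4 Lemma 4.3] -/
theorem shard630 :
    Shard.check 128 (2^40)
      ⟨true, 80, 114, 169, 123, 182, 12417878731441, 17392040082164⟩ = true := by
  decide +kernel

set_option maxHeartbeats 100000000 in
/-- Shard 631: 80 cells of regime B from `123/182` to `239/353`.
[cite: Lai2024BallRivoal, §4 Lemma 4.3] -/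
theorem shard631 :
    Shard.check 128 (2^40)
      ⟨true, 80, 123, 182, 239, 353, 12024831791305, 16858983384521⟩ = true := by
  decide +kernel

set_option maxHeartbeats 100000000 in
/-- Shard 632: 80 cells of regime B from `239/353` to `97/143`.
[cite: Lai2024BallRivoal, §4 Lemma 4.3] -/
theorem shard632 :
    Shard.check 128 (2^40)
      ⟨true, 80, 239, 353, 97, 143, 12392057042186, 17391879061537⟩ = true := by
  decide +kernel

set_option maxHeartbeats 100000000 in
/-- Shard 633: 80 cells of regime B from `97/143` to `297/437`.
[cite: Lai2024BallRivoal, §4 Lemma 4.3] -/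
theorem shard633 :
    Shard.check 128 (2^40)
      ⟨true, 80, 97, 143, 297, 437, 12808283208001, 17995321102118⟩ = true := by
  decide +kernel

set_option maxHeartbeats 100000000 in
/-- Shard 634: 80 cells of regime B from `297/437` to `3271/4804`.
[cite: Lai2024BallRivoal, §4 Lemma 4.3] -/
theorem shard634 :
    Shard.check 128 (2^40)
      ⟨true, 80, 297, 437, 3271, 4804, 12257656786804, 17240115398307⟩ = true := by
  decide +kernel

set_option maxHeartbeats 100000000 in
/-- Shard 635: 80 cells of regime B from `3271/4804` to `103/151`.
[cite: Lai2024BallRivoal, §4 Lemma 4.3] -/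
theorem shard635 :
    Shard.check 128 (2^40)
      ⟨true, 80, 3271, 4804, 103, 151, 11955698697788, 16832824470222⟩ = true := by
  decide +kernel

set_option maxHeartbeats 100000000 in
/-- Shard 636: 80 cells of regime B from `103/151` to `300/439`.
[cite: Lai2024BallRivoal, §4 Lemma 4.3] -/
theorem shard636 :
    Shard.check 128 (2^40)
      ⟨true, 80, 103, 151, 300, 439, 12176476921258, 17161240042814⟩ = true := by
  decide +kernel

/-- The checked shards of this file, in order. [folklore] -/
def shards090 : List (CheckedShard 128 (2^40)) :=
  [⟨_, shard630⟩, ⟨_, shard631⟩, ⟨_, shard632⟩, ⟨_, shard633⟩, ⟨_, shard634⟩,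
    ⟨_, shard635⟩, ⟨_, shard636⟩]

end Summit.KontsevichZagierPeriods.Zeta5Search.Sweep
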